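import Literature.MathematicalPhysics.PowerSystems.StructurePreservingDichotomy
import Literature.MathematicalPhysics.PowerSystems.NonuniformKuramotoDichotomy
import HarnessLib

/-!
# The cutset (power-balance) necessary condition for synchronization, and its consequence for EVERY
# motion: an overloaded cutset desynchronizes the network from every initial state
# (Dörfler–Bullo, *Automatica* 2014 survey, Lemma 4.2 «Necessary sync condition» and its cutset
# extension; read with the frame-correct dichotomies of this topic)

Topic `Literature/MathematicalPhysics/PowerSystems`. Records used unchanged: `NonuniformKuramoto n`
(first-order / droop-controlled inverters, `NonuniformKuramotoPhaseCohesiveness.lean`),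
`ClassicalModel.LosslessSystem n m` (lossless classical multimachine model,
`LosslessMultimachineRegionOfAttraction.lean`), `BergenHill n` (structure-preserving model,
`StructurePreservingModel.lean`), `DroopNetwork n`. Everything below is PROVED (no definition, no
named fact, no new axiom).

SOURCES (read on the page).

* F. Dörfler, F. Bullo, «Synchronization in complex networks of phase oscillators: A survey»,
  Automatica 50 (2014) 1539–1564 [DorflerBullo2014] (held: `lit read
  paper:doi-10-1016-j-automatica-2014-04-012`, p0015 L20–L57): «the sinusoidal interaction terms in
  equation (1) are upper bounded by the nodal degree `degᵢ = Σⱼ aᵢⱼ` of each oscillator. Hence, the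
  natural frequencies have to satisfy certain bounds, relative to the nodal degree, if a synchronized
  solution is to exist. **Lemma 4.2 (Necessary sync condition)** … If there exists a synchronized
  solution `θ ∈ Δ_G(γ)` for some `γ ∈ [0, π/2]`, then: 1) Absolute bound: for each node
  `degᵢ sin(γ) ≥ |ωᵢ|` (27); 2) Incremental bound: `(degᵢ + degⱼ) sin(γ) ≥ |ωᵢ − ωⱼ|` (28). This
  lemma follows directly from the fact that synchronized solutions must satisfy `θ̇ᵢ = 0` … Along the
  same lines, condition (27) can also be extended from a single node to a cutset in the graph
  (Ainsworth and Grijalva, 2013, Theorem 1).» (model (1): `θ̇ᵢ = ωᵢ − Σⱼ aᵢⱼ sin(θᵢ − θⱼ)`,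
  `ω ∈ 1⊥`, p0001 L60–L61; the primary of the cutset form, Ainsworth–Grijalva 2013 Thm 1, is
  requested as acq-13235 and NOT read — the cutset statement below is the elementary summation the
  survey names, proved here, cited to the survey's sentence.)
* F. Dörfler, F. Bullo, SIAM J. Control Optim. 50 (2012) [DorflerBullo2012], arXiv:0910.5673 §5.2
  Lemma 5.2 (pairwise necessary condition; typed in `NonuniformKuramotoPhaseCohesiveness.lean`).
* The necessity halves of the dichotomies of this topic (no synchronized solution ⇒ loss of
  synchronism from EVERY state): `NonuniformKuramoto.unbounded_sub_of_no_syncSolution`,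
  `ClassicalModel.LosslessSystem.unbounded_sub_of_no_syncEquilibrium` /
  `tendsto_norm_angles_atTop_of_no_equilibrium`, `BergenHill.unbounded_sub_of_no_syncEquilibrium`
  (Leonov 2001 Ch. 4 §4.2, remark after Thm 4.1: «in the absence of equilibrium, all the solutions
  are unbounded»; Chiang 1995 Thm 3.1).

## What is proved

* §1 THE SUMMATION. `sum_sum_mul_sin_sub_eq_zero` (symmetric weights: `Σ_{i∈S}Σ_{j∈S} Wᵢⱼ sin(xᵢ −
  xⱼ) = 0`), `sum_sum_mul_sin_sub_eq_cut` (`Σ_{i∈S}Σⱼ Wᵢⱼ sin(xᵢ − xⱼ) = Σ_{i∈S}Σ_{j∉S} …`),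
  `abs_sum_sum_mul_sin_sub_le_cut` (`|Σ_{i∈S}Σⱼ Wᵢⱼ sin(xᵢ − xⱼ)| ≤ Σ_{i∈S}Σ_{j∉S}|Wᵢⱼ|`): the
  power a node set `S` exports through sinusoidal couplings is carried by the CUT edges only and is
  bounded by the cut capacity — for EVERY angle vector (`γ = π/2`, no arc restriction).
* §2 FIRST ORDER (`NonuniformKuramoto`, zero phase shifts, `P` symmetric, `Dᵢ > 0`).
  `abs_sum_shifted_le_cut_of_field_eq` (a synchronized solution `θ̇ᵢ = c ∀i` forces
  `|Σ_{i∈S}(ωᵢ − Dᵢc)| ≤ Σ_{i∈S}Σ_{j∉S}|Pᵢⱼ|` for every `S`), **`unbounded_sub_of_cut`** /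
  `tendsto_sum_abs_sub_atTop_of_cut` (if ONE node set violates it at `c = ω_sync = Σω/ΣD` —
  `Σ_{i∈S}Σ_{j∉S}|Pᵢⱼ| < |Σ_{i∈S}(ωᵢ − Dᵢω_sync)|` — then EVERY motion has unbounded phase
  differences and `Σᵢ|ω̃ᵢ||θᵢ − θₖ| → ∞` for every `k`), the single-node case
  `unbounded_sub_of_node` ((27) violated at `γ = π/2`), and the droop reading
  `DroopNetwork.unbounded_sub_of_cut`.
* §3 SECOND ORDER (`LosslessSystem n m`, `C` symmetric, `Mᵢ, Dᵢ > 0`).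
  `abs_sum_P_le_cut_of_isEquilibrium` (an equilibrium forces `|Σ_{i∈S} Pᵢ| ≤ Σ_{i∈S}(Σ_{j∉S}|Cᵢⱼ|
  + Σ_b|Kᵢb|)`), **`tendsto_norm_angles_atTop_of_cut`** (violated ⇒ every motion has `V → −∞` and
  `‖θ‖ → ∞`); isolated networks `m = 0` in the synchronous frame: `abs_sum_shifted_le_cut_of_syncEq`,
  **`unbounded_sub_of_cut_isolated`** (violated with `P̃ᵢ = Pᵢ − DᵢΣP/ΣD` ⇒ every motion loses
  synchronism between machines).
* §4 STRUCTURE PRESERVING (`BergenHill n`, `b` symmetric, `Mᵢ ≥ 0`, `Dᵢ > 0`):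
  `BergenHill.abs_sum_shiftedInjection_le_cut_of_flow_eq`, **`BergenHill.unbounded_sub_of_cut`**.

THREE COLUMNS. CERTIFIED: kernel theorems; for a typed network the hypothesis is ONE rational
inequality for ONE node set (sum of `|coupling|` over the cut edges vs. the net shifted injection of
the set). MODELLED: the respective model classes (MV-2 / MV-3 / droop). NOT CLAIMED: the converse
(a satisfied cut condition certifies nothing — sufficient conditions are ★ #96-type rows); which
machines separate; any rate.
-/

noncomputable section

open Real Set Filter Topology Metric Finset

namespace Literature.MathematicalPhysics.PowerSystems

/-! ### §1. The summation over a node set: internal sinusoidal couplings cancel -/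

/-- **Internal couplings cancel** (antisymmetry): for symmetric weights `W` and any angles `x`,
`Σ_{i∈S} Σ_{j∈S} Wᵢⱼ sin(xᵢ − xⱼ) = 0`. [cite: DorflerBullo2014, §4 Lemma 4.2 and proof sketch (p0015 L50–L57); DorflerBullo2012, arXiv:0910.5673 §5.1 proof of Thm 5.1 (`𝟙ᵀ` annihilates the symmetric coupling)] -/
theorem sum_sum_mul_sin_sub_eq_zero {n : ℕ} (W : Fin n → Fin n → ℝ) (hW : ∀ i j, W i j = W j i)
    (x : Fin n → ℝ) (S : Finset (Fin n)) :
    ∑ i ∈ S, ∑ j ∈ S, W i j * Real.sin (x i - x j) = 0 := by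
  set T := ∑ i ∈ S, ∑ j ∈ S, W i j * Real.sin (x i - x j) with hT
  have h : T = -T := by
    calc T = ∑ j ∈ S, ∑ i ∈ S, W i j * Real.sin (x i - x j) := by rw [hT, Finset.sum_comm]
      _ = ∑ j ∈ S, ∑ i ∈ S, -(W j i * Real.sin (x j - x i)) := by
          refine Finset.sum_congr rfl fun j _ => Finset.sum_congr rfl fun i _ => ?_
          have hs : Real.sin (x j - x i) = -Real.sin (x i - x j) := by
            rw [← Real.sin_neg, neg_sub]
          rw [hW i j, hs]
          ring
      _ = -T := by simp only [Finset.sum_neg_distrib, hT]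
  linarith

/-- **Only the cut edges carry the export of a node set**: for symmetric `W`,
`Σ_{i∈S} Σⱼ Wᵢⱼ sin(xᵢ − xⱼ) = Σ_{i∈S} Σ_{j∉S} Wᵢⱼ sin(xᵢ − xⱼ)`.
[cite: DorflerBullo2014, §4 text after Lemma 4.2 («condition (27) can also be extended from a single node to a cutset», p0015 L54–L57)] -/
theorem sum_sum_mul_sin_sub_eq_cut {n : ℕ} (W : Fin n → Fin n → ℝ) (hW : ∀ i j, W i j = W j i)
    (x : Fin n → ℝ) (S : Finset (Fin n)) :
    ∑ i ∈ S, ∑ j, W i j * Real.sin (x i - x j)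
      = ∑ i ∈ S, ∑ j ∈ Sᶜ, W i j * Real.sin (x i - x j) := by
  have hsplit : ∀ i, ∑ j, W i j * Real.sin (x i - x j)
      = ∑ j ∈ S, W i j * Real.sin (x i - x j) + ∑ j ∈ Sᶜ, W i j * Real.sin (x i - x j) :=
    fun i => (Finset.sum_add_sum_compl S _).symm
  simp only [hsplit, Finset.sum_add_distrib, sum_sum_mul_sin_sub_eq_zero W hW x S, zero_add]

/-- **The cut capacity bounds the export**: for symmetric `W` and EVERY angle vector,
`|Σ_{i∈S} Σⱼ Wᵢⱼ sin(xᵢ − xⱼ)| ≤ Σ_{i∈S} Σ_{j∉S} |Wᵢⱼ|` («the sinusoidal interaction terms … are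
upper bounded by the nodal degree», summed over the cut). [cite: DorflerBullo2014, §4 Lemma 4.2 (27) and the cutset sentence (p0015 L20–L57)] -/
theorem abs_sum_sum_mul_sin_sub_le_cut {n : ℕ} (W : Fin n → Fin n → ℝ) (hW : ∀ i j, W i j = W j i)
    (x : Fin n → ℝ) (S : Finset (Fin n)) :
    |∑ i ∈ S, ∑ j, W i j * Real.sin (x i - x j)| ≤ ∑ i ∈ S, ∑ j ∈ Sᶜ, |W i j| := by
  rw [sum_sum_mul_sin_sub_eq_cut W hW x S]
  refine (Finset.abs_sum_le_sum_abs _ _).trans (Finset.sum_le_sum fun i _ => ?_)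
  refine (Finset.abs_sum_le_sum_abs _ _).trans (Finset.sum_le_sum fun j _ => ?_)
  rw [abs_mul]
  exact mul_le_of_le_one_right (abs_nonneg _) (Real.abs_sin_le_one _)

/-! ### §2. First order: non-uniform Kuramoto oscillators / droop-controlled inverters -/

namespace NonuniformKuramoto

variable {n : ℕ} (K : NonuniformKuramoto n)

/-- **The cutset condition is necessary for a synchronized solution** (zero phase shifts, `P`
symmetric, `Dᵢ > 0`): if `θ̇ᵢ = c` for every `i` at the phase vector `x` (a synchronized solution
with common frequency `c`), then for EVERY node set `S`,
`|Σ_{i∈S} (ωᵢ − Dᵢ c)| ≤ Σ_{i∈S} Σ_{j∉S} |Pᵢⱼ|`: the net shifted natural frequency of `S` must be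
exportable through the cut. (Single node `S = {i}`: (27) at `γ = π/2`.)
[cite: DorflerBullo2014, §4 Lemma 4.2 (27) and the cutset sentence (p0015 L30–L57); DorflerBullo2012, arXiv:0910.5673 §5.2 Lemma 5.2] -/
theorem abs_sum_shifted_le_cut_of_field_eq (hD : ∀ i, 0 < K.D i) (hP : ∀ i j, K.P i j = K.P j i)
    (hφ : ∀ i j, K.φ i j = 0) {x : Fin n → ℝ} {c : ℝ} (hx : ∀ i, K.field x i = c)
    (S : Finset (Fin n)) :
    |∑ i ∈ S, (K.ω i - K.D i * c)| ≤ ∑ i ∈ S, ∑ j ∈ Sᶜ, |K.P i j| := by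
  have hbal : ∀ i, K.ω i - K.D i * c = ∑ j, K.P i j * Real.sin (x i - x j) := by
    intro i
    have h := hx i
    unfold field at h
    have hDi := (hD i).ne'
    have h' : K.ω i - ∑ j, K.P i j * Real.sin (x i - x j + K.φ i j) = K.D i * c := by
      rw [← h]; field_simp
    simp only [hφ, add_zero] at h'
    linarith
  simp only [hbal]
  exact abs_sum_sum_mul_sin_sub_le_cut K.P hP x S

/-- Contrapositive: if ONE node set violates the cutset condition at the synchronous frequency
`ω_sync = Σω/ΣD` — `Σ_{i∈S}Σ_{j∉S}|Pᵢⱼ| < |Σ_{i∈S}(ωᵢ − Dᵢ ω_sync)|` — then NO phase vector is a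
synchronized solution: at every `x` some `θ̇ᵢ ≠ ω_sync`. [cite: DorflerBullo2014, §4 Lemma 4.2 and the cutset sentence (p0015 L30–L57)] -/
theorem exists_field_ne_syncFreq_of_cut (hD : ∀ i, 0 < K.D i) (hP : ∀ i j, K.P i j = K.P j i)
    (hφ : ∀ i j, K.φ i j = 0) {S : Finset (Fin n)}
    (hcut : ∑ i ∈ S, ∑ j ∈ Sᶜ, |K.P i j|
      < |∑ i ∈ S, (K.ω i - K.D i * ((∑ j, K.ω j) / ∑ j, K.D j))|) (x : Fin n → ℝ) :
    ∃ i, K.field x i ≠ (∑ j, K.ω j) / ∑ j, K.D j := by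
  by_contra h
  push Not at h
  exact absurd (K.abs_sum_shifted_le_cut_of_field_eq hD hP hφ h S) (not_le.2 hcut)

/-- **An overloaded cutset desynchronizes the network from EVERY initial state** (zero phase shifts,
`P` symmetric, `Dᵢ > 0`, any `n`, any topology): if some node set `S` has
`Σ_{i∈S}Σ_{j∉S}|Pᵢⱼ| < |Σ_{i∈S}(ωᵢ − Dᵢ ω_sync)|`, then along EVERY motion the phase differences are
unbounded: for every `B` there are `t ≥ 0` and `i, j` with `|θᵢ(t) − θⱼ(t)| > B`. The necessary
condition read dynamically: not merely «no synchronized solution exists» but «no motion stays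
cohesive». [cite: DorflerBullo2014, §4 Lemma 4.2 + cutset sentence (p0015 L30–L57); Leonov2001, Ch. 4 §4.2, remark after Thm 4.1] -/
theorem unbounded_sub_of_cut (hD : ∀ i, 0 < K.D i) (hP : ∀ i j, K.P i j = K.P j i)
    (hφ : ∀ i j, K.φ i j = 0) {S : Finset (Fin n)}
    (hcut : ∑ i ∈ S, ∑ j ∈ Sᶜ, |K.P i j|
      < |∑ i ∈ S, (K.ω i - K.D i * ((∑ j, K.ω j) / ∑ j, K.D j))|)
    {θ : ℝ → Fin n → ℝ}
    (hθ : ∀ T : ℝ, ∀ t ∈ Icc 0 T, HasDerivWithinAt θ (K.field (θ t)) (Icc 0 T) t) (B : ℝ) :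
    ∃ t, 0 ≤ t ∧ ∃ i j, B < |θ t i - θ t j| :=
  K.unbounded_sub_of_no_syncSolution hD hP hφ hθ (K.exists_field_ne_syncFreq_of_cut hD hP hφ hcut) B

/-- The same, weighted form: `Σᵢ |ωᵢ − Dᵢω_sync|·|θᵢ(t) − θₖ(t)| → +∞` for EVERY reference
oscillator `k`, along every motion. [cite: DorflerBullo2014, §4 Lemma 4.2 + cutset sentence (p0015 L30–L57); Chiang1995, §3 Thm 3.1] -/
theorem tendsto_sum_abs_sub_atTop_of_cut (hD : ∀ i, 0 < K.D i) (hP : ∀ i j, K.P i j = K.P j i)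
    (hφ : ∀ i j, K.φ i j = 0) {S : Finset (Fin n)}
    (hcut : ∑ i ∈ S, ∑ j ∈ Sᶜ, |K.P i j|
      < |∑ i ∈ S, (K.ω i - K.D i * ((∑ j, K.ω j) / ∑ j, K.D j))|)
    {θ : ℝ → Fin n → ℝ}
    (hθ : ∀ T : ℝ, ∀ t ∈ Icc 0 T, HasDerivWithinAt θ (K.field (θ t)) (Icc 0 T) t) (k : Fin n) :
    Tendsto (fun t => ∑ i, |K.ω i - K.D i * ((∑ j, K.ω j) / ∑ j, K.D j)| * |θ t i - θ t k|)
      atTop atTop :=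
  K.tendsto_sum_abs_sub_atTop_of_no_syncSolution hD hP hφ hθ
    (K.exists_field_ne_syncFreq_of_cut hD hP hφ hcut) k

/-- **Single overloaded node** ((27) violated at `γ = π/2`): if `Σ_{j≠i}|Pᵢⱼ| < |ωᵢ − Dᵢ ω_sync|`
for ONE oscillator `i` (its shifted natural frequency exceeds its total coupling), then every motion
has unbounded phase differences. [cite: DorflerBullo2014, §4 Lemma 4.2 (27) (p0015 L30–L44)] -/
theorem unbounded_sub_of_node (hD : ∀ i, 0 < K.D i) (hP : ∀ i j, K.P i j = K.P j i)
    (hφ : ∀ i j, K.φ i j = 0) {i : Fin n}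
    (hnode : ∑ j ∈ ({i} : Finset (Fin n))ᶜ, |K.P i j|
      < |K.ω i - K.D i * ((∑ j, K.ω j) / ∑ j, K.D j)|)
    {θ : ℝ → Fin n → ℝ}
    (hθ : ∀ T : ℝ, ∀ t ∈ Icc 0 T, HasDerivWithinAt θ (K.field (θ t)) (Icc 0 T) t) (B : ℝ) :
    ∃ t, 0 ≤ t ∧ ∃ i j, B < |θ t i - θ t j| :=
  K.unbounded_sub_of_cut hD hP hφ (S := {i}) (by simpa using hnode) hθ B

end NonuniformKuramoto

namespace DroopNetwork

variable {n : ℕ} (N : DroopNetwork n)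

/-- **Droop reading** (SPDB2013 Lemma 1: `ωᵢ = Pᵢ*`, `Pᵢⱼ = aᵢⱼ = EᵢEⱼ|Yᵢⱼ|`, `φ = 0`; `Dᵢ > 0`,
`|Y|` symmetric): if some set `S` of inverters has `Σ_{i∈S}Σ_{j∉S}|aᵢⱼ| < |Σ_{i∈S}(Pᵢ* − Dᵢ ω_sync)|`
with `ω_sync = ΣPᵢ*/ΣDᵢ` — the set's net scheduled injection in the synchronous frame exceeds the
capacity of the lines leaving it — then EVERY motion of the microgrid has unbounded angle
differences. [cite: DorflerBullo2014, §4 Lemma 4.2 + cutset sentence (p0015 L30–L57); SimpsonporcoDorflerBullo2013, §3 Lemma 1] -/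
theorem unbounded_sub_of_cut (hD : ∀ i, 0 < N.Dc i) (hY : ∀ i j, N.Yabs i j = N.Yabs j i)
    {S : Finset (Fin n)}
    (hcut : ∑ i ∈ S, ∑ j ∈ Sᶜ, |N.a i j|
      < |∑ i ∈ S, (N.Pstar i - N.Dc i * ((∑ j, N.Pstar j) / ∑ j, N.Dc j))|)
    {θ : ℝ → Fin n → ℝ}
    (hθ : ∀ T : ℝ, ∀ t ∈ Icc 0 T, HasDerivWithinAt θ (N.toKuramoto.field (θ t)) (Icc 0 T) t)
    (B : ℝ) : ∃ t, 0 ≤ t ∧ ∃ i j, B < |θ t i - θ t j| :=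
  N.toKuramoto.unbounded_sub_of_cut hD (N.toKuramoto_P_symm hY) (fun _ _ => rfl) hcut hθ B

end DroopNetwork

/-! ### §3. Second order: the lossless classical multimachine model -/

namespace ClassicalModel.LosslessSystem

variable {n m : ℕ} (S : LosslessSystem n m)

/-- **The cutset condition is necessary for an equilibrium** (`C` symmetric; any `m` buses of
constant angle): an equilibrium angle vector forces, for EVERY machine set `A`,
`|Σ_{i∈A} Pᵢ| ≤ Σ_{i∈A} (Σ_{j∉A} |Cᵢⱼ| + Σ_b |Kᵢb|)` — the set's net power must leave through its
cut lines and its bus ties. [cite: DorflerBullo2014, §4 Lemma 4.2 + cutset sentence (p0015 L30–L57), §2 (power network model (9)); VuTuritsyn2016, §II eq. (2)] -/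
theorem abs_sum_P_le_cut_of_isEquilibrium (hC : ∀ i j, S.C i j = S.C j i) {θ : Fin n → ℝ}
    (hθ : S.IsEquilibrium θ) (A : Finset (Fin n)) :
    |∑ i ∈ A, S.P i| ≤ ∑ i ∈ A, (∑ j ∈ Aᶜ, |S.C i j| + ∑ b, |S.K i b|) := by
  have hP : ∀ i, S.P i = (∑ j, S.C i j * Real.sin (θ i - θ j))
      + ∑ b, S.K i b * Real.sin (θ i - S.β b) := fun i => hθ i
  simp only [hP, Finset.sum_add_distrib]
  refine (abs_add_le _ _).trans (add_le_add (abs_sum_sum_mul_sin_sub_le_cut S.C hC θ A) ?_)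
  refine (Finset.abs_sum_le_sum_abs _ _).trans (Finset.sum_le_sum fun i _ => ?_)
  refine (Finset.abs_sum_le_sum_abs _ _).trans (Finset.sum_le_sum fun b _ => ?_)
  rw [abs_mul]
  exact mul_le_of_le_one_right (abs_nonneg _) (Real.abs_sin_le_one _)

/-- Contrapositive: a violated cutset leaves NO equilibrium. [cite: DorflerBullo2014, §4 Lemma 4.2 + cutset sentence (p0015 L30–L57)] -/
theorem not_isEquilibrium_of_cut (hC : ∀ i j, S.C i j = S.C j i) {A : Finset (Fin n)}
    (hcut : ∑ i ∈ A, (∑ j ∈ Aᶜ, |S.C i j| + ∑ b, |S.K i b|) < |∑ i ∈ A, S.P i|)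
    (θ : Fin n → ℝ) : ¬ S.IsEquilibrium θ := fun hθ =>
  absurd (S.abs_sum_P_le_cut_of_isEquilibrium hC hθ A) (not_le.2 hcut)

/-- **An overloaded cutset makes EVERY motion lose energy without bound and the rotor angles
diverge** (`C` symmetric, `Mᵢ, Dᵢ > 0`, any `n`, any `m`): if some machine set `A` has
`Σ_{i∈A}(Σ_{j∉A}|Cᵢⱼ| + Σ_b|Kᵢb|) < |Σ_{i∈A} Pᵢ|`, then along every motion `V → −∞`,
`Σ Pᵢθᵢ → +∞` and `‖θ(t)‖ → ∞`. (With an infinite bus present this is loss of synchronism with the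
bus; for `m = 0` use the frame-correct form `unbounded_sub_of_cut_isolated`.)
[cite: DorflerBullo2014, §4 Lemma 4.2 + cutset sentence (p0015 L30–L57); Leonov2001, Ch. 4 §4.2, remark after Thm 4.1; Chiang1995, §3 Thm 3.1] -/
theorem tendsto_norm_angles_atTop_of_cut (hC : ∀ i j, S.C i j = S.C j i) (hM : ∀ i, 0 < S.M i)
    (hD : ∀ i, 0 < S.D i) {A : Finset (Fin n)}
    (hcut : ∑ i ∈ A, (∑ j ∈ Aᶜ, |S.C i j| + ∑ b, |S.K i b|) < |∑ i ∈ A, S.P i|)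
    {X : ℝ → (Fin n → ℝ) × (Fin n → ℝ)}
    (hX : ∀ T : ℝ, ∀ t ∈ Icc 0 T, HasDerivWithinAt X (S.field (X t)) (Icc 0 T) t) :
    Tendsto (fun t => S.energy (X t)) atTop atBot ∧
      Tendsto (fun t => ∑ i, S.P i * (X t).1 i) atTop atTop ∧
      Tendsto (fun t => ‖(X t).1‖) atTop atTop := by
  have hne := S.not_isEquilibrium_of_cut hC hcut
  obtain ⟨h1, h2⟩ := S.tendsto_energy_atBot_of_no_equilibrium hC hM hD hX hne
  exact ⟨h1, h2, S.tendsto_norm_angles_atTop_of_no_equilibrium hC hM hD hX hne⟩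

end ClassicalModel.LosslessSystem

namespace ClassicalModel.LosslessSystem

variable {n : ℕ} (S : LosslessSystem n 0)

/-- Isolated network (`m = 0`), synchronous frame: a synchronized solution — `Pᵢ − Dᵢc = flowᵢ(θ)`
for all `i` with a common `c` — forces `|Σ_{i∈A}(Pᵢ − Dᵢc)| ≤ Σ_{i∈A}Σ_{j∉A}|Cᵢⱼ|` for every
machine set `A` (`C` symmetric). [cite: DorflerBullo2014, §4 Lemma 4.2 + cutset sentence (p0015 L30–L57), §2 (9)] -/
theorem abs_sum_shifted_le_cut_of_syncEq (hC : ∀ i j, S.C i j = S.C j i) {θ : Fin n → ℝ} {c : ℝ}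
    (hθ : ∀ i, S.P i - S.D i * c = S.flow θ i) (A : Finset (Fin n)) :
    |∑ i ∈ A, (S.P i - S.D i * c)| ≤ ∑ i ∈ A, ∑ j ∈ Aᶜ, |S.C i j| := by
  have h : ∀ i, S.P i - S.D i * c = ∑ j, S.C i j * Real.sin (θ i - θ j) := fun i => by
    rw [hθ i]; simp [flow]
  simp only [h]
  exact abs_sum_sum_mul_sin_sub_le_cut S.C hC θ A

/-- **An overloaded cutset of an isolated lossless network desynchronizes EVERY motion** (`m = 0`,
`C` symmetric, `Mᵢ, Dᵢ > 0`): if some machine set `A` has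
`Σ_{i∈A}Σ_{j∉A}|Cᵢⱼ| < |Σ_{i∈A}(Pᵢ − Dᵢ ΣP/ΣD)|` (its net power in the frame of the common drift
exceeds the capacity of its cut), then along every motion the rotor-angle differences are unbounded.
[cite: DorflerBullo2014, §4 Lemma 4.2 + cutset sentence (p0015 L30–L57); Leonov2001, Ch. 4 §4.2, remark after Thm 4.1] -/
theorem unbounded_sub_of_cut_isolated (hC : ∀ i j, S.C i j = S.C j i) (hM : ∀ i, 0 < S.M i)
    (hD : ∀ i, 0 < S.D i) {A : Finset (Fin n)}
    (hcut : ∑ i ∈ A, ∑ j ∈ Aᶜ, |S.C i j|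
      < |∑ i ∈ A, (S.P i - S.D i * ((∑ j, S.P j) / ∑ j, S.D j))|)
    {X : ℝ → (Fin n → ℝ) × (Fin n → ℝ)}
    (hX : ∀ T : ℝ, ∀ t ∈ Icc 0 T, HasDerivWithinAt X (S.field (X t)) (Icc 0 T) t) (B : ℝ) :
    ∃ t, 0 ≤ t ∧ ∃ i j, B < |(X t).1 i - (X t).1 j| := by
  refine S.unbounded_sub_of_no_syncEquilibrium hC hM hD hX (fun θ => ?_) B
  by_contra h
  push Not at h
  exact absurd (S.abs_sum_shifted_le_cut_of_syncEq hC h A) (not_le.2 hcut)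

/-- Weighted form for isolated networks: `Σᵢ|P̃ᵢ||θᵢ(t) − θₖ(t)| → +∞` for every reference machine
`k`, along every motion. [cite: DorflerBullo2014, §4 Lemma 4.2 + cutset sentence (p0015 L30–L57); Chiang1995, §3 Thm 3.1] -/
theorem tendsto_sum_abs_sub_atTop_of_cut_isolated (hC : ∀ i j, S.C i j = S.C j i)
    (hM : ∀ i, 0 < S.M i) (hD : ∀ i, 0 < S.D i) {A : Finset (Fin n)}
    (hcut : ∑ i ∈ A, ∑ j ∈ Aᶜ, |S.C i j|
      < |∑ i ∈ A, (S.P i - S.D i * ((∑ j, S.P j) / ∑ j, S.D j))|)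
    {X : ℝ → (Fin n → ℝ) × (Fin n → ℝ)}
    (hX : ∀ T : ℝ, ∀ t ∈ Icc 0 T, HasDerivWithinAt X (S.field (X t)) (Icc 0 T) t) (k : Fin n) :
    Tendsto (fun t => ∑ i, |S.P i - S.D i * ((∑ j, S.P j) / ∑ j, S.D j)| *
      |(X t).1 i - (X t).1 k|) atTop atTop := by
  refine S.tendsto_sum_abs_sub_atTop_of_no_syncEquilibrium hC hM hD hX (fun θ => ?_) k
  by_contra h
  push Not at h
  exact absurd (S.abs_sum_shifted_le_cut_of_syncEq hC h A) (not_le.2 hcut)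

end ClassicalModel.LosslessSystem

/-! ### §4. The structure-preserving model (load buses included) -/

namespace BergenHill

variable {n : ℕ} (S : BergenHill n)

/-- A synchronous equilibrium of the structure-preserving model — `Σⱼ bᵢⱼ sin(θᵢ − θⱼ) = P̄ᵢ` at every
bus, `P̄ᵢ = P⁰ᵢ − Dᵢω₀` — forces `|Σ_{i∈A} P̄ᵢ| ≤ Σ_{i∈A}Σ_{j∉A}|bᵢⱼ|` for EVERY bus set `A`
(`b` symmetric). [cite: DorflerBullo2014, §4 Lemma 4.2 + cutset sentence (p0015 L30–L57), §2 (structure-preserving model (9)); Padiyar2013, §3.2 eq. (3.5)] -/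
theorem abs_sum_shiftedInjection_le_cut_of_flow_eq (hb : ∀ i j, S.b i j = S.b j i)
    {θ : Fin n → ℝ} (hθ : ∀ i, S.flow θ i = S.shiftedInjection i) (A : Finset (Fin n)) :
    |∑ i ∈ A, S.shiftedInjection i| ≤ ∑ i ∈ A, ∑ j ∈ Aᶜ, |S.b i j| := by
  have h : ∀ i, S.shiftedInjection i = ∑ j, S.b i j * Real.sin (θ i - θ j) := fun i => by
    rw [← hθ i]; rfl
  simp only [h]
  exact abs_sum_sum_mul_sin_sub_le_cut S.b hb θ A

/-- **An overloaded cutset of the structure-preserving network desynchronizes EVERY motion**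
(`b` symmetric, `Mᵢ ≥ 0`, `Dᵢ > 0` at every bus): if some bus set `A` has
`Σ_{i∈A}Σ_{j∉A}|bᵢⱼ| < |Σ_{i∈A} P̄ᵢ|`, then along every solution the bus-angle differences are
unbounded — generators AND loads included. [cite: DorflerBullo2014, §4 Lemma 4.2 + cutset sentence (p0015 L30–L57); Leonov2001, Ch. 4 §4.2, remark after Thm 4.1] -/
theorem unbounded_sub_of_cut (hb : ∀ i j, S.b i j = S.b j i) (hM : ∀ i, 0 ≤ S.M i)
    (hD : ∀ i, 0 < S.D i) {A : Finset (Fin n)}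
    (hcut : ∑ i ∈ A, ∑ j ∈ Aᶜ, |S.b i j| < |∑ i ∈ A, S.shiftedInjection i|)
    {δ v : ℝ → Fin n → ℝ} (hsol : ∀ t, 0 ≤ t → S.IsSolutionAt δ v t) (B : ℝ) :
    ∃ t, 0 ≤ t ∧ ∃ i j, B < |δ t i - δ t j| := by
  refine S.unbounded_sub_of_no_syncEquilibrium hb hM hD hsol (fun θ => ?_) B
  by_contra h
  push Not at h
  exact absurd (S.abs_sum_shiftedInjection_le_cut_of_flow_eq hb h A) (not_le.2 hcut)

/-- Weighted form: `Σᵢ|P̄ᵢ||δᵢ(t) − δₖ(t)| → +∞` for every reference bus `k`, along every solution.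
[cite: DorflerBullo2014, §4 Lemma 4.2 + cutset sentence (p0015 L30–L57); Chiang1995, §3 Thm 3.1] -/
theorem tendsto_sum_abs_sub_atTop_of_cut (hb : ∀ i j, S.b i j = S.b j i) (hM : ∀ i, 0 ≤ S.M i)
    (hD : ∀ i, 0 < S.D i) {A : Finset (Fin n)}
    (hcut : ∑ i ∈ A, ∑ j ∈ Aᶜ, |S.b i j| < |∑ i ∈ A, S.shiftedInjection i|)
    {δ v : ℝ → Fin n → ℝ} (hsol : ∀ t, 0 ≤ t → S.IsSolutionAt δ v t) (k : Fin n) :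
    Tendsto (fun t => ∑ i, |S.shiftedInjection i| * |δ t i - δ t k|) atTop atTop := by
  refine S.tendsto_sum_abs_sub_atTop_of_no_syncEquilibrium hb hM hD hsol (fun θ => ?_) k
  by_contra h
  push Not at h
  exact absurd (S.abs_sum_shiftedInjection_le_cut_of_flow_eq hb h A) (not_le.2 hcut)

end BergenHill

end Literature.MathematicalPhysics.PowerSystems

end
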